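import Summits.BirchSwinnertonDyer.BirchSwinnertonDyer.Theorems.CyclotomicUntwistUntwistedLFunctionExistence
import Summits.BirchSwinnertonDyer.BirchSwinnertonDyer.Theorems.CyclotomicUntwistCanonicalEigensymbol
import HarnessLib

/-!
# Untwist eigensymbols, V: the untwisted `p`-adic `L`-function (D1) EXISTS iff the canonical symbol is
# bounded — the route's want F1 in the tree's existing vocabulary

Cell `pub/bsd-wall` (D-0145 line `route-BirchSwinnertonDyer-CyclotomicUntwist`), seat `bsd-line-cycu-p3`
(prover seat 3/3), helper toward crux K1 `PSRankOneLowerHalfAtThree` (stmt-BirchSwinnertonDyer-21580) and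
its want F1 (`wi-84943`, `∃ 𝓛, IsPSCyclotomicLFunctionOf W η α 𝓛`).  Fifth (last) file of the series
(`…EigensymbolPushforward`, `…EigensymbolCharValues`, `…UntwistedLFunctionExistence`,
`…CanonicalEigensymbol`, this).  THEOREMS ONLY (no definition, no named fact, no `sorry`).  BSD is not proved
by this file and no crux of the route is proved by it.

WHAT.  For a prime `p`, `f ∈ S₂(Γ₀(N))`, `η` a PRIMITIVE Dirichlet character mod `p^c` (`c ≥ 1`) with values
in `ℂ_p` and `α ∈ ℂ_p`, `α ≠ p`, put `H(r) = ∑_{b mod p^c} η(b)[r + b/p^c]⁺_f` and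
`T(r, n) = ∑_{k<n} (α/p)ᵏ H(pᵏ r) + (α/p)ⁿ(1 − α/p)⁻¹ H(0)` (file IV).

* §1 `exists_canonical_symbol`: there is `Ψ : ℚ → ℂ_p` with `Ψ(a/pⁿ) = T(a/pⁿ, n)` for all `n`, `a : ℤ`
  (well-definedness on `ℤ[1/p]`: file IV `canonical_robust`, with `Ψ(r) := T(r, v_p(den r))`), and every such
  `Ψ` is an untwist eigensymbol on `ℤ[1/p]` — (S1), (S2), (S3) of file III (`canonical_symbol_isEigensymbol`,
  `exists_eigensymbol`; from file IV, with `U_p H = 0` by primitivity).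
* §2 `exists_isUntwistedPAdicLFunction_of_canonical_bounded`: if moreover `α ≠ 0`, `‖α⁻¹‖ ≤ √p` and the
  canonical values `T(a/pⁿ, n)` are bounded, then `∃ μ, IsUntwistedPAdicLFunction p f η α μ` (file III's main
  theorem applied to `Ψ`); conversely `norm_canonical_le_of_eigensymbol`: the values of ANY (S1)+(S3)
  symbol on `ℤ[1/p]` ARE the canonical values (file IV `eq_of_deprivation`), so a bounded eigensymbol exists
  iff the canonical values are bounded (`exists_bounded_eigensymbol_iff`).
* §3 W-level (`p = 3`, `c = 2`): `exists_isPSCyclotomicLFunctionOf_of_canonical_bounded`.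

So F1 reads, with NO new definition: «for some primitive `η` mod `9` and some `α` (`α ≠ 0, 3`, `‖α⁻¹‖ ≤ √3`)
the explicit `3`-adic numbers `T_{f,η,α}(a/3ⁿ, n)` are bounded» — true for `α = a₃(g)`, `g` the newform of
`f ⊗ η̄` of level `9M` on a principal-series row (the `g`-symbol `τ(η){∞,·}⁺_g/Ω⁺_f` is an (S1)+(S3) symbol,
hence equals `Ψ`, and has bounded denominators: Mazur–Tate–Teitelbaum §I.14, Bellaïche Thm. 6.7.9,
Atkin–Li Thm. 3.1, Manin–Drinfeld), and — by uniqueness of D1's object (tree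
`PSGammaUniqueness.eq_of_isUntwistedPAdicLFunction`) — the ONLY way an order-`½` `𝓛` can exist.

References: [cite: MazurTateTeitelbaum1986Invent, §I.10 and §I.14] · [cite: Bellaiche2021, Thm. 6.7.9]
· [cite: AtkinLi1978, Thm. 3.1].
-/

noncomputable section

open Finset
open Literature.NumberTheory.EllipticCurves Literature.NumberTheory.EllipticCurves.ModularForms
  Literature.NumberTheory.IwasawaTheory

-- single-conjunct summit: `Summit.BirchSwinnertonDyer.BirchSwinnertonDyer.…` repeats the name by design
set_option linter.dupNamespace false

namespace Summit.BirchSwinnertonDyer.BirchSwinnertonDyer.Theorems.PSUntwistExistence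

variable {p : ℕ} [Fact p.Prime] {N : ℕ} {f : CuspForm (CongruenceSubgroup.Gamma0 N) 2} {c : ℕ}
  {η : DirichletCharacter ℂ_[p] (p ^ c)} {α : ℂ_[p]} {Ψ Φ : ℚ → ℂ_[p]}

/-! ### §1 The canonical symbol exists on `ℤ[1/p]` and is an untwist eigensymbol -/

/-- A point `a/pⁿ` of `ℤ[1/p]` times `p^{v_p(den)}` is an integer (its numerator): the reduced denominator
divides `pⁿ`, so it is `p^j` with `j = v_p(den)`. [folklore] -/
theorem exists_pow_padicValNat_den_mul_eq (n : ℕ) (a : ℤ) :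
    ∃ z : ℤ, (p : ℚ) ^ padicValNat p ((a : ℚ) / (p : ℚ) ^ n).den * ((a : ℚ) / (p : ℚ) ^ n) = z := by
  have hp : p.Prime := Fact.out
  set r : ℚ := (a : ℚ) / (p : ℚ) ^ n with hr
  have hdvd : r.den ∣ p ^ n := by
    have h := Rat.den_dvd a ((p ^ n : ℕ) : ℤ)
    rw [Rat.divInt_eq_div, Int.cast_natCast, Nat.cast_pow, ← hr] at h
    exact_mod_cast h
  obtain ⟨j, -, hj⟩ := (Nat.dvd_prime_pow hp).mp hdvd
  refine ⟨r.num, ?_⟩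
  rw [hj, padicValNat.prime_pow, ← Rat.mul_den_eq_num r, hj, Nat.cast_pow, mul_comm]

/-- **The canonical symbol exists**: for `α ≠ p` there is `Ψ : ℚ → ℂ_p` with
`Ψ(a/pⁿ) = ∑_{k<n} (α/p)ᵏ H(pᵏ a/pⁿ) + (α/p)ⁿ(1 − α/p)⁻¹ H(0)` for ALL representations `a/pⁿ` of points of
`ℤ[1/p]` (`H` the `p`-deprived twisted symbol of `(f, η)`): take `Ψ(r) := T(r, v_p(den r))` and use the
robustness of `T` (file IV `canonical_robust`). [cite: MazurTateTeitelbaum1986Invent, §I.14] -/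
theorem exists_canonical_symbol [NeZero N] (f : CuspForm (CongruenceSubgroup.Gamma0 N) 2)
    (η : DirichletCharacter ℂ_[p] (p ^ c)) (hαp : α ≠ p) :
    ∃ Ψ : ℚ → ℂ_[p], ∀ (n : ℕ) (a : ℤ), Ψ ((a : ℚ) / (p : ℚ) ^ n) =
      ∑ k ∈ range n, (α / p) ^ k *
          (∑ b : ZMod (p ^ c), η b * algebraMap ℚ ℂ_[p]
            (ratPlusSymbol f ((p : ℚ) ^ k * ((a : ℚ) / (p : ℚ) ^ n) + (b.val : ℚ) / (p : ℚ) ^ c))) +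
        (α / p) ^ n * (1 - α / p)⁻¹ *
          ∑ b : ZMod (p ^ c), η b * algebraMap ℚ ℂ_[p] (ratPlusSymbol f (0 + (b.val : ℚ) / (p : ℚ) ^ c)) := by
  have hp0 : (p : ℂ_[p]) ≠ 0 := Nat.cast_ne_zero.mpr (Fact.out : p.Prime).ne_zero
  have hq : α / p ≠ 1 := fun h ↦ hαp (by rwa [div_eq_one_iff_eq hp0] at h)
  set H : ℚ → ℂ_[p] := fun r ↦
    ∑ b : ZMod (p ^ c), η b * algebraMap ℚ ℂ_[p] (ratPlusSymbol f (r + (b.val : ℚ) / (p : ℚ) ^ c)) with hH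
  have hH1 : ∀ (r : ℚ) (z : ℤ), H (r + z) = H r := twistSymbol_add_intCast (fun _ ↦ rfl)
  refine ⟨fun r ↦ ∑ k ∈ range (padicValNat p r.den), (α / p) ^ k * H ((p : ℚ) ^ k * r) +
    (α / p) ^ (padicValNat p r.den) * (1 - α / p)⁻¹ * H 0, fun n a ↦ ?_⟩
  -- both `v_p(den)` and `n` are admissible cut-offs; compare them at `max`
  have hv := canonical_robust hH1 hq (exists_pow_padicValNat_den_mul_eq n a)
    (le_max_left (padicValNat p ((a : ℚ) / (p : ℚ) ^ n).den) n)
  have hn := canonical_robust hH1 hq ⟨a, pow_mul_div_pow_eq n a⟩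
    (le_max_right (padicValNat p ((a : ℚ) / (p : ℚ) ^ n).den) n)
  simp only [hH] at hv hn ⊢
  rw [← hv, hn]

/-- The hypotheses on the twisted symbol that files III/IV consume, discharged: `H` is `ℤ`-periodic and,
for `η` primitive with `c ≥ 1`, killed by `U_p` (file IV). [cite: Bellaiche2021, §6.7.2] -/
theorem twistSymbol_periodic_and_sum_div_eq_zero [NeZero N] (hη : η.IsPrimitive) (hc : 1 ≤ c) :
    (∀ (r : ℚ) (z : ℤ),
      (∑ b : ZMod (p ^ c), η b * algebraMap ℚ ℂ_[p] (ratPlusSymbol f (r + z + (b.val : ℚ) / (p : ℚ) ^ c))) =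
        ∑ b : ZMod (p ^ c), η b * algebraMap ℚ ℂ_[p] (ratPlusSymbol f (r + (b.val : ℚ) / (p : ℚ) ^ c))) ∧
    ∀ r : ℚ, ∑ j : Fin p,
      (∑ b : ZMod (p ^ c), η b *
        algebraMap ℚ ℂ_[p] (ratPlusSymbol f ((r + j) / p + (b.val : ℚ) / (p : ℚ) ^ c))) = 0 := by
  refine ⟨twistSymbol_add_intCast (H := fun r ↦ ∑ b : ZMod (p ^ c), η b *
    algebraMap ℚ ℂ_[p] (ratPlusSymbol f (r + (b.val : ℚ) / (p : ℚ) ^ c))) (fun _ ↦ rfl), ?_⟩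
  obtain ⟨c', rfl⟩ : ∃ c', c = c' + 1 := ⟨c - 1, by omega⟩
  exact sum_twistSymbol_div_eq_zero (f := f) hη (H := fun r ↦ ∑ b : ZMod (p ^ (c' + 1)), η b *
    algebraMap ℚ ℂ_[p] (ratPlusSymbol f (r + (b.val : ℚ) / (p : ℚ) ^ (c' + 1)))) (fun _ ↦ rfl)

/-- **The canonical symbol is an untwist eigensymbol on `ℤ[1/p]`**: any `Ψ` with
`Ψ(a/pⁿ) = T(a/pⁿ, n)` (as in `exists_canonical_symbol`) satisfies (S1) `Ψ(a/pⁿ + z) = Ψ(a/pⁿ)`,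
(S2) `∑_{j mod p} Ψ((a/pⁿ + j)/p) = α Ψ(a/pⁿ)` and (S3) `Ψ(a/pⁿ) − (α/p)Ψ(p·a/pⁿ) = H(a/pⁿ)`, for `η` primitive
mod `p^c`, `c ≥ 1`, `α ≠ p` (file IV §3 with `U_p H = 0`).  No other condition on `α`: additivity and the
interpolation clauses of D1 do not see `α`. [cite: MazurTateTeitelbaum1986Invent, §I.14] [cite: Bellaiche2021, Thm. 6.7.9] -/
theorem canonical_symbol_isEigensymbol [NeZero N] (hη : η.IsPrimitive) (hc : 1 ≤ c) (hαp : α ≠ p)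
    (hΨ : ∀ (n : ℕ) (a : ℤ), Ψ ((a : ℚ) / (p : ℚ) ^ n) =
      ∑ k ∈ range n, (α / p) ^ k *
          (∑ b : ZMod (p ^ c), η b * algebraMap ℚ ℂ_[p]
            (ratPlusSymbol f ((p : ℚ) ^ k * ((a : ℚ) / (p : ℚ) ^ n) + (b.val : ℚ) / (p : ℚ) ^ c))) +
        (α / p) ^ n * (1 - α / p)⁻¹ *
          ∑ b : ZMod (p ^ c), η b * algebraMap ℚ ℂ_[p] (ratPlusSymbol f (0 + (b.val : ℚ) / (p : ℚ) ^ c))) :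
    (∀ (n : ℕ) (a z : ℤ), Ψ ((a : ℚ) / (p : ℚ) ^ n + z) = Ψ ((a : ℚ) / (p : ℚ) ^ n)) ∧
    (∀ (n : ℕ) (a : ℤ), ∑ j : Fin p, Ψ (((a : ℚ) / (p : ℚ) ^ n + j) / p) = α * Ψ ((a : ℚ) / (p : ℚ) ^ n)) ∧
    (∀ (n : ℕ) (a : ℤ), Ψ ((a : ℚ) / (p : ℚ) ^ n) - α / p * Ψ (p * ((a : ℚ) / (p : ℚ) ^ n)) =
      ∑ b : ZMod (p ^ c), η b *
        algebraMap ℚ ℂ_[p] (ratPlusSymbol f ((a : ℚ) / (p : ℚ) ^ n + (b.val : ℚ) / (p : ℚ) ^ c))) := by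
  have hp0 : (p : ℂ_[p]) ≠ 0 := Nat.cast_ne_zero.mpr (Fact.out : p.Prime).ne_zero
  have hq : α / p ≠ 1 := fun h ↦ hαp (by rwa [div_eq_one_iff_eq hp0] at h)
  obtain ⟨hH1, hH2⟩ := twistSymbol_periodic_and_sum_div_eq_zero (f := f) hη hc
  set H : ℚ → ℂ_[p] := fun r ↦
    ∑ b : ZMod (p ^ c), η b * algebraMap ℚ ℂ_[p] (ratPlusSymbol f (r + (b.val : ℚ) / (p : ℚ) ^ c)) with hH
  have hH1' : ∀ (r : ℚ) (z : ℤ), H (r + z) = H r := hH1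
  have hH2' : ∀ r : ℚ, ∑ j : Fin p, H ((r + j) / p) = 0 := hH2
  have hΨ' : ∀ (n : ℕ) (a : ℤ), Ψ ((a : ℚ) / (p : ℚ) ^ n) =
      ∑ k ∈ range n, (α / p) ^ k * H ((p : ℚ) ^ k * ((a : ℚ) / (p : ℚ) ^ n)) +
        (α / p) ^ n * (1 - α / p)⁻¹ * H 0 := hΨ
  exact ⟨canonical_add_intCast hH1' hΨ', sum_canonical_div_eq hH1' hH2' hΨ',
    canonical_deprivation hH1' hq hΨ'⟩

/-- **An untwist eigensymbol on `ℤ[1/p]` always exists** (for `η` primitive mod `p^c`, `c ≥ 1`, `α ≠ p`):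
(S1), (S2), (S3) of file III are satisfied by the canonical symbol.  Only (S4) (boundedness) can fail.
[cite: MazurTateTeitelbaum1986Invent, §I.14] [cite: Bellaiche2021, Thm. 6.7.9] -/
theorem exists_eigensymbol [NeZero N] (f : CuspForm (CongruenceSubgroup.Gamma0 N) 2)
    (hη : η.IsPrimitive) (hc : 1 ≤ c) (hαp : α ≠ p) :
    ∃ Ψ : ℚ → ℂ_[p],
      (∀ (n : ℕ) (a z : ℤ), Ψ ((a : ℚ) / (p : ℚ) ^ n + z) = Ψ ((a : ℚ) / (p : ℚ) ^ n)) ∧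
      (∀ (n : ℕ) (a : ℤ), ∑ j : Fin p, Ψ (((a : ℚ) / (p : ℚ) ^ n + j) / p) = α * Ψ ((a : ℚ) / (p : ℚ) ^ n)) ∧
      (∀ (n : ℕ) (a : ℤ), Ψ ((a : ℚ) / (p : ℚ) ^ n) - α / p * Ψ (p * ((a : ℚ) / (p : ℚ) ^ n)) =
        ∑ b : ZMod (p ^ c), η b *
          algebraMap ℚ ℂ_[p] (ratPlusSymbol f ((a : ℚ) / (p : ℚ) ^ n + (b.val : ℚ) / (p : ℚ) ^ c))) := by
  obtain ⟨Ψ, hΨ⟩ := exists_canonical_symbol f η hαp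
  exact ⟨Ψ, canonical_symbol_isEigensymbol hη hc hαp hΨ⟩

/-! ### §2 Existence of the D1 object iff the canonical values are bounded -/

/-- **EXISTENCE OF THE UNTWISTED `p`-ADIC `L`-FUNCTION FROM BOUNDED CANONICAL VALUES.**  For `η` primitive
mod `p^c` (`c ≥ 1`), `α ≠ 0, p` with `‖α⁻¹‖ ≤ √p`: if the canonical values
`T(a/pⁿ, n) = ∑_{k<n}(α/p)ᵏ H(pᵏa/pⁿ) + (α/p)ⁿ(1 − α/p)⁻¹H(0)` are bounded (`‖T‖ ≤ C`), then
`∃ μ, IsUntwistedPAdicLFunction p f η α μ` — the canonical symbol is a bounded untwist eigensymbol and file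
III applies.  This is D1's existence with the Γ₁-side input replaced by an explicit growth statement about
sums of rational plus symbols of `f`. [cite: MazurTateTeitelbaum1986Invent, §I.10 and §I.14] [cite: Bellaiche2021, Thm. 6.7.9] -/
theorem exists_isUntwistedPAdicLFunction_of_canonical_bounded [NeZero N]
    (f : CuspForm (CongruenceSubgroup.Gamma0 N) 2) (hη : η.IsPrimitive) (hc : 1 ≤ c)
    (hα : α ≠ 0) (hαp : α ≠ p) (hαn : ‖α⁻¹‖ ≤ (p : ℝ) ^ (1 / 2 : ℝ))
    (hbd : ∃ C : ℝ, ∀ (n : ℕ) (a : ℤ),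
      ‖∑ k ∈ range n, (α / p) ^ k *
          (∑ b : ZMod (p ^ c), η b * algebraMap ℚ ℂ_[p]
            (ratPlusSymbol f ((p : ℚ) ^ k * ((a : ℚ) / (p : ℚ) ^ n) + (b.val : ℚ) / (p : ℚ) ^ c))) +
        (α / p) ^ n * (1 - α / p)⁻¹ *
          ∑ b : ZMod (p ^ c), η b * algebraMap ℚ ℂ_[p] (ratPlusSymbol f (0 + (b.val : ℚ) / (p : ℚ) ^ c))‖
        ≤ C) :
    ∃ μ : (n : ℕ) → ZMod (p ^ n) → ℂ_[p], IsUntwistedPAdicLFunction p f η α μ := by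
  obtain ⟨Ψ, hΨ⟩ := exists_canonical_symbol f η hαp
  obtain ⟨h1, h2, h3⟩ := canonical_symbol_isEigensymbol hη hc hαp hΨ
  obtain ⟨C, hC⟩ := hbd
  exact exists_isUntwistedPAdicLFunction_of_eigensymbol f η hα hαp hαn h1 h2 h3
    ⟨C, fun n a ↦ by rw [hΨ]; exact hC n a⟩

/-- **Conversely, the values of ANY (S1)+(S3) symbol on `ℤ[1/p]` are the canonical values** (file IV
`eq_of_deprivation`): so its bound is a bound for them.  With the previous theorem: a bounded untwist
eigensymbol exists iff the canonical values are bounded — the `g`-symbol of print, if `g` exists with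
`U_p g = αg`, is the canonical symbol. [cite: MazurTateTeitelbaum1986Invent, §I.14] -/
theorem norm_canonical_le_of_eigensymbol [NeZero N] (hη : η.IsPrimitive) (hc : 1 ≤ c) (hαp : α ≠ p)
    (hper : ∀ (n : ℕ) (a z : ℤ), Φ ((a : ℚ) / (p : ℚ) ^ n + z) = Φ ((a : ℚ) / (p : ℚ) ^ n))
    (hdep : ∀ (n : ℕ) (a : ℤ), Φ ((a : ℚ) / (p : ℚ) ^ n) - α / p * Φ (p * ((a : ℚ) / (p : ℚ) ^ n)) =
      ∑ b : ZMod (p ^ c), η b *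
        algebraMap ℚ ℂ_[p] (ratPlusSymbol f ((a : ℚ) / (p : ℚ) ^ n + (b.val : ℚ) / (p : ℚ) ^ c)))
    {C : ℝ} (hbd : ∀ (n : ℕ) (a : ℤ), ‖Φ ((a : ℚ) / (p : ℚ) ^ n)‖ ≤ C) (n : ℕ) (a : ℤ) :
    ‖∑ k ∈ range n, (α / p) ^ k *
        (∑ b : ZMod (p ^ c), η b * algebraMap ℚ ℂ_[p]
          (ratPlusSymbol f ((p : ℚ) ^ k * ((a : ℚ) / (p : ℚ) ^ n) + (b.val : ℚ) / (p : ℚ) ^ c))) +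
      (α / p) ^ n * (1 - α / p)⁻¹ *
        ∑ b : ZMod (p ^ c), η b * algebraMap ℚ ℂ_[p] (ratPlusSymbol f (0 + (b.val : ℚ) / (p : ℚ) ^ c))‖
      ≤ C := by
  have hp0 : (p : ℂ_[p]) ≠ 0 := Nat.cast_ne_zero.mpr (Fact.out : p.Prime).ne_zero
  have hq : α / p ≠ 1 := fun h ↦ hαp (by rwa [div_eq_one_iff_eq hp0] at h)
  obtain ⟨Ψ, hΨ⟩ := exists_canonical_symbol f η hαp
  obtain ⟨h1, -, h3⟩ := canonical_symbol_isEigensymbol hη hc hαp hΨ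
  rw [← hΨ, ← eq_of_deprivation (H := fun r ↦ ∑ b : ZMod (p ^ c), η b *
    algebraMap ℚ ℂ_[p] (ratPlusSymbol f (r + (b.val : ℚ) / (p : ℚ) ^ c))) hq hper hdep h1 h3 n a]
  exact hbd n a

/-- **A bounded untwist eigensymbol on `ℤ[1/p]` exists iff the canonical values are bounded** (`η` primitive
mod `p^c`, `c ≥ 1`, `α ≠ p`). [cite: MazurTateTeitelbaum1986Invent, §I.14] [cite: Bellaiche2021, Thm. 6.7.9] -/
theorem exists_bounded_eigensymbol_iff [NeZero N] (f : CuspForm (CongruenceSubgroup.Gamma0 N) 2)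
    (hη : η.IsPrimitive) (hc : 1 ≤ c) (hαp : α ≠ p) :
    (∃ Φ : ℚ → ℂ_[p],
      (∀ (n : ℕ) (a z : ℤ), Φ ((a : ℚ) / (p : ℚ) ^ n + z) = Φ ((a : ℚ) / (p : ℚ) ^ n)) ∧
      (∀ (n : ℕ) (a : ℤ), ∑ j : Fin p, Φ (((a : ℚ) / (p : ℚ) ^ n + j) / p) = α * Φ ((a : ℚ) / (p : ℚ) ^ n)) ∧
      (∀ (n : ℕ) (a : ℤ), Φ ((a : ℚ) / (p : ℚ) ^ n) - α / p * Φ (p * ((a : ℚ) / (p : ℚ) ^ n)) =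
        ∑ b : ZMod (p ^ c), η b *
          algebraMap ℚ ℂ_[p] (ratPlusSymbol f ((a : ℚ) / (p : ℚ) ^ n + (b.val : ℚ) / (p : ℚ) ^ c))) ∧
      ∃ C : ℝ, ∀ (n : ℕ) (a : ℤ), ‖Φ ((a : ℚ) / (p : ℚ) ^ n)‖ ≤ C) ↔
    ∃ C : ℝ, ∀ (n : ℕ) (a : ℤ),
      ‖∑ k ∈ range n, (α / p) ^ k *
          (∑ b : ZMod (p ^ c), η b * algebraMap ℚ ℂ_[p]
            (ratPlusSymbol f ((p : ℚ) ^ k * ((a : ℚ) / (p : ℚ) ^ n) + (b.val : ℚ) / (p : ℚ) ^ c))) +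
        (α / p) ^ n * (1 - α / p)⁻¹ *
          ∑ b : ZMod (p ^ c), η b * algebraMap ℚ ℂ_[p] (ratPlusSymbol f (0 + (b.val : ℚ) / (p : ℚ) ^ c))‖
        ≤ C := by
  constructor
  · rintro ⟨Φ, h1, -, h3, C, hC⟩
    exact ⟨C, norm_canonical_le_of_eigensymbol hη hc hαp h1 h3 hC⟩
  · rintro ⟨C, hC⟩
    obtain ⟨Ψ, hΨ⟩ := exists_canonical_symbol f η hαp
    obtain ⟨h1, h2, h3⟩ := canonical_symbol_isEigensymbol hη hc hαp hΨ
    exact ⟨Ψ, h1, h2, h3, C, fun n a ↦ by rw [hΨ]; exact hC n a⟩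

/-! ### §3 W-level: the principal-series cyclotomic `3`-adic `L`-function from bounded canonical values -/

/-- **W-level (route `CyclotomicUntwist`, D1 / F1).**  For a Weierstrass curve `W/ℚ` with newform `f`
(`IsNewformOf W f`), `η` PRIMITIVE mod `9` with values in `ℂ₃`, and `α ∈ ℂ₃` with `α ≠ 0, 3`, `‖α⁻¹‖ ≤ √3`:
if the canonical values `T_{f,η,α}(a/3ⁿ, n)` (explicit finite sums of `η`-twisted rational plus symbols of
`f`, weighted by powers of `α/3`) are `3`-adically bounded, then `∃ 𝓛, IsPSCyclotomicLFunctionOf W η α 𝓛`.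
In print the hypothesis holds for `α = a₃(g)`, `g` the newform of `f ⊗ η̄` (level `9M`, slope `½`) on a
principal-series row: the `g`-symbol is the canonical symbol (file IV `eq_of_deprivation`) and has bounded
denominators (Mazur–Tate–Teitelbaum §I.14; Bellaïche Thm. 6.7.9; Atkin–Li Thm. 3.1; Manin–Drinfeld).  This
is the route's want F1 stated in the tree's existing vocabulary.
[cite: MazurTateTeitelbaum1986Invent, §I.14 (case p ∣ N, a_p ≠ 0)] [cite: Bellaiche2021, Thm. 6.7.9] [cite: AtkinLi1978, Thm. 3.1] -/
theorem exists_isPSCyclotomicLFunctionOf_of_canonical_bounded (W : WeierstrassCurve ℚ) {N : ℕ} [NeZero N]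
    (f : CuspForm (CongruenceSubgroup.Gamma0 N) 2) (hf : IsNewformOf W f)
    {η : DirichletCharacter ℂ_[3] (3 ^ 2)} (hη : η.IsPrimitive) {α : ℂ_[3]} (hα : α ≠ 0) (hα3 : α ≠ 3)
    (hαn : ‖α⁻¹‖ ≤ (3 : ℝ) ^ (1 / 2 : ℝ))
    (hbd : ∃ C : ℝ, ∀ (n : ℕ) (a : ℤ),
      ‖∑ k ∈ range n, (α / 3) ^ k *
          (∑ b : ZMod (3 ^ 2), η b * algebraMap ℚ ℂ_[3]
            (ratPlusSymbol f ((3 : ℚ) ^ k * ((a : ℚ) / (3 : ℚ) ^ n) + (b.val : ℚ) / (3 : ℚ) ^ 2))) +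
        (α / 3) ^ n * (1 - α / 3)⁻¹ *
          ∑ b : ZMod (3 ^ 2), η b * algebraMap ℚ ℂ_[3] (ratPlusSymbol f (0 + (b.val : ℚ) / (3 : ℚ) ^ 2))‖
        ≤ C) :
    ∃ 𝓛 : (n : ℕ) → ZMod (3 ^ n) → ℂ_[3], IsPSCyclotomicLFunctionOf W η α 𝓛 := by
  obtain ⟨μ, hμ⟩ := exists_isUntwistedPAdicLFunction_of_canonical_bounded (p := 3) f hη (by norm_num) hα
    (by exact_mod_cast hα3) (by exact_mod_cast hαn) (by exact_mod_cast hbd)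
  exact ⟨μ, N, inferInstance, f, hf, hμ⟩

end Summit.BirchSwinnertonDyer.BirchSwinnertonDyer.Theorems.PSUntwistExistence

end
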